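import Summits.ValiantsHypothesis.ValiantsHypothesis.Theorems.GrenetZeonDualUnipotentThreeHalvesHeavyTopIrreducibleData
import Summits.ValiantsHypothesis.ValiantsHypothesis.Theorems.GrenetZeonDualUnipotentThreeHalvesRadicalCoarseningFineFlag
import Literature.LinearAlgebra.Matrix.AdjugateOfNilpotent

/-!
# `GrenetZeon.DualUnipotentThreeHalves` (stmt-ValiantsHypothesis-24318), R2 `HeavyTopLaw` — ι(4) = 3 ASSEMBLY, part (A):
# conjugated spaces, pulled-back endings, the square-zero case (htc cell PREREG Q2; eng-1 spec 18:12:43Z S1/S2(a))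

Plumbing for the kernel assembly of «every nilpotent subspace of `M₄(ℂ)` of dimension `≥ 4` is reducible»
(eng-1 `NOTE-iota4.md`; pieces ✓ p654162/p655736 (T1), ✓ p655235/p655522/p655765 (T2)):

* `pow_four_eq_zero` (S1): a nilpotent `4 × 4` matrix has `A⁴ = 0` (✓ Literature `pow_card_eq_zero_of_isNilpotent`);
* conjugated spaces `V' = Q·V·P` (`Q P = P Q = 1`): membership both ways, `finrank` preserved, powers transported;
* the two ENDINGS pulled back through the conjugation: if every `Q X P`, `X ∈ V`, has zero FIRST COLUMN then
  `ℂ·(P e₁)` is a common kernel line of `V` (`reducible_of_conj_col_zero`); if every `Q X P` has zero LAST ROW then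
  the hyperplane `{y : (Q y)₄ = 0}` is `V`-invariant (`reducible_of_conj_row_zero`);
* case (a) of the assembly: a space of square-zero matrices containing a non-zero member is reducible
  (`reducible_of_forall_sq_zero`, via ✓ `HeavyTopIrreducibleData.reducible_of_sq_zero`).

«Reducible» is spelled out as `∃ U : Submodule ℂ (Fin 4 → ℂ), U ≠ ⊥ ∧ U ≠ ⊤ ∧ ∀ A ∈ V, ∀ u ∈ U, A *ᵥ u ∈ U`.
Honest framing: lemmas toward a datum (ι(4) = 3) of the instance table; nothing here proves or refutes `HeavyTopLaw`,
24318, S3b or 8062; `VP ≠ VNP` is not moved; no summit statement is proved here.  No definitions, no named facts.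
[eng-1 NOTE-iota4 / assembly spec; val-port-3 g2]
-/

noncomputable section

-- single-conjunct layout: Sub = Summit, duplicated namespace component intended
set_option linter.dupNamespace false

namespace Summit.ValiantsHypothesis.ValiantsHypothesis.Theorems.GrenetZeon.HeavyTopIotaFour

open Matrix
open Summit.ValiantsHypothesis.ValiantsHypothesis.Theorems.GrenetZeon.HeavyTopIrreducibleData (reducible_of_sq_zero)
open Literature.LinearAlgebra.Matrix.AdjugateOfNilpotent (pow_card_eq_zero_of_isNilpotent)

/-! ## §1 S1: nilpotent `4 × 4` matrices have `A⁴ = 0` -/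

/-- A nilpotent `4 × 4` complex matrix satisfies `A⁴ = 0` (Cayley–Hamilton). [folklore] -/
theorem pow_four_eq_zero (A : Matrix (Fin 4) (Fin 4) ℂ) (h : IsNilpotent A) : A ^ 4 = 0 := by
  have := pow_card_eq_zero_of_isNilpotent h
  simpa using this

/-- On a space of nilpotent `4 × 4` matrices, `A⁴ ≡ 0`. -/
theorem pow_four_eq_zero_of_mem (V : Submodule ℂ (Matrix (Fin 4) (Fin 4) ℂ)) (hV : ∀ A ∈ V, IsNilpotent A) :
    ∀ A ∈ V, A ^ 4 = 0 := fun A hA => pow_four_eq_zero A (hV A hA)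

/-! ## §2 Conjugated spaces `V' = Q·V·P` -/

section Conj

variable {m : ℕ}

/-- The standard basis vector `e_j` is mapped by `M` to the `j`-th column of `M`. -/
theorem mulVec_single_one_apply (M : Matrix (Fin m) (Fin m) ℂ) (i j : Fin m) :
    (M *ᵥ (Pi.single j 1 : Fin m → ℂ)) i = M i j := by
  simp [Matrix.mulVec]

/-- A matrix all of whose columns `M e_j` vanish is zero. -/
theorem eq_zero_of_forall_mulVec_single (M : Matrix (Fin m) (Fin m) ℂ)
    (h : ∀ j, M *ᵥ (Pi.single j 1 : Fin m → ℂ) = 0) : M = 0 := by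
  ext i j
  have := congrFun (h j) i
  rwa [mulVec_single_one_apply] at this

/-- Membership in the conjugated space: `X ∈ V ⇒ Q X P ∈ Q·V·P`. -/
theorem conj_mem_map (Q P : Matrix (Fin m) (Fin m) ℂ) (V : Submodule ℂ (Matrix (Fin m) (Fin m) ℂ))
    {X : Matrix (Fin m) (Fin m) ℂ} (hX : X ∈ V) :
    Q * X * P ∈ V.map ((LinearMap.mulLeft ℂ Q).comp (LinearMap.mulRight ℂ P)) := by
  refine Submodule.mem_map.2 ⟨X, hX, ?_⟩
  simp [Matrix.mul_assoc]

/-- Every member of the conjugated space is `Q X P` for some `X ∈ V`. -/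
theorem exists_of_mem_map_conj (Q P : Matrix (Fin m) (Fin m) ℂ) (V : Submodule ℂ (Matrix (Fin m) (Fin m) ℂ))
    {Y : Matrix (Fin m) (Fin m) ℂ} (hY : Y ∈ V.map ((LinearMap.mulLeft ℂ Q).comp (LinearMap.mulRight ℂ P))) :
    ∃ X ∈ V, Y = Q * X * P := by
  obtain ⟨X, hX, rfl⟩ := Submodule.mem_map.1 hY
  exact ⟨X, hX, by simp [Matrix.mul_assoc]⟩

/-- Conjugation by mutually inverse matrices is injective, so it preserves `finrank`. -/
theorem finrank_map_conj (Q P : Matrix (Fin m) (Fin m) ℂ) (hPQ : P * Q = 1)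
    (V : Submodule ℂ (Matrix (Fin m) (Fin m) ℂ)) :
    Module.finrank ℂ (V.map ((LinearMap.mulLeft ℂ Q).comp (LinearMap.mulRight ℂ P))) = Module.finrank ℂ V := by
  have hinj : Function.Injective ((LinearMap.mulLeft ℂ Q).comp (LinearMap.mulRight ℂ P)) := by
    intro X Y hXY
    simp only [LinearMap.coe_comp, Function.comp_apply, LinearMap.mulRight_apply, LinearMap.mulLeft_apply] at hXY
    have : P * (Q * (X * P)) * Q = P * (Q * (Y * P)) * Q := by rw [hXY]
    simpa [Matrix.mul_assoc, hPQ, ← Matrix.mul_assoc P Q] using this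
  exact (LinearEquiv.finrank_eq (Submodule.equivMapOfInjective _ hinj V)).symm

/-- Powers are transported: `(Q X P)^(k+1) = Q X^(k+1) P` when `P Q = 1`. -/
theorem conj_pow_succ (Q P : Matrix (Fin m) (Fin m) ℂ) (hPQ : P * Q = 1) (X : Matrix (Fin m) (Fin m) ℂ) :
    ∀ k : ℕ, (Q * X * P) ^ (k + 1) = Q * X ^ (k + 1) * P
  | 0 => by rw [zero_add, pow_one, pow_one]
  | k + 1 => by
      rw [pow_succ, conj_pow_succ Q P hPQ X k, pow_succ X (k + 1)]
      simp only [Matrix.mul_assoc]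
      rw [← Matrix.mul_assoc P Q, hPQ, Matrix.one_mul]

/-- If `X^p = 0` on `V` (`p ≥ 1`) then `Y^p = 0` on the conjugated space. -/
theorem pow_eq_zero_of_mem_map_conj (Q P : Matrix (Fin m) (Fin m) ℂ) (hPQ : P * Q = 1)
    (V : Submodule ℂ (Matrix (Fin m) (Fin m) ℂ)) {p : ℕ} (hp : 1 ≤ p) (hV : ∀ X ∈ V, X ^ p = 0)
    {Y : Matrix (Fin m) (Fin m) ℂ} (hY : Y ∈ V.map ((LinearMap.mulLeft ℂ Q).comp (LinearMap.mulRight ℂ P))) :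
    Y ^ p = 0 := by
  obtain ⟨X, hX, rfl⟩ := exists_of_mem_map_conj Q P V hY
  obtain ⟨k, rfl⟩ := Nat.exists_eq_add_of_le' hp
  rw [conj_pow_succ Q P hPQ X k, hV X hX, Matrix.mul_zero, Matrix.zero_mul]

end Conj

/-! ## §3 The two endings, pulled back through the conjugation -/

/-- **Column ending, pulled back.**  If every conjugate `Q X P`, `X ∈ V`, has zero first column, then the line
spanned by `P e₁` is killed by every member of `V` — a common invariant line. [NOTE-iota4 §2c/§3; spec S2] -/
theorem reducible_of_conj_col_zero (V : Submodule ℂ (Matrix (Fin 4) (Fin 4) ℂ))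
    (Q P : Matrix (Fin 4) (Fin 4) ℂ) (hQP : Q * P = 1) (hPQ : P * Q = 1)
    (hcol : ∀ X ∈ V, ∀ i, (Q * X * P) i 0 = 0) :
    ∃ U : Submodule ℂ (Fin 4 → ℂ), U ≠ ⊥ ∧ U ≠ ⊤ ∧ ∀ A ∈ V, ∀ u ∈ U, A *ᵥ u ∈ U := by
  set u₀ : Fin 4 → ℂ := P *ᵥ (Pi.single 0 1 : Fin 4 → ℂ) with hu₀
  have hu₀ne : u₀ ≠ 0 := by
    intro h
    have : (Q * P) *ᵥ (Pi.single 0 1 : Fin 4 → ℂ) = 0 := by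
      rw [← Matrix.mulVec_mulVec, ← hu₀, h, Matrix.mulVec_zero]
    rw [hQP, Matrix.one_mulVec] at this
    simpa using congrFun this 0
  have hkill : ∀ A ∈ V, A *ᵥ u₀ = 0 := by
    intro A hA
    have h1 : (Q * A * P) *ᵥ (Pi.single 0 1 : Fin 4 → ℂ) = 0 := by
      ext i; rw [mulVec_single_one_apply]; exact hcol A hA i
    have h2 : A * P = P * (Q * A * P) := by
      simp only [← Matrix.mul_assoc]; rw [hPQ, Matrix.one_mul]
    rw [hu₀, Matrix.mulVec_mulVec, h2, ← Matrix.mulVec_mulVec, h1, Matrix.mulVec_zero]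
  refine ⟨Submodule.span ℂ {u₀}, ?_, ?_, ?_⟩
  · rw [Ne, Submodule.span_singleton_eq_bot]; exact hu₀ne
  · intro htop
    have h1 : Module.finrank ℂ (Submodule.span ℂ ({u₀} : Set (Fin 4 → ℂ))) = 1 := finrank_span_singleton hu₀ne
    rw [htop, finrank_top, Module.finrank_fin_fun] at h1
    norm_num at h1
  · intro A hA u hu
    obtain ⟨c, rfl⟩ := Submodule.mem_span_singleton.1 hu
    rw [Matrix.mulVec_smul, hkill A hA, smul_zero]
    exact Submodule.zero_mem _

/-- **Row ending, pulled back.**  If every conjugate `Q X P`, `X ∈ V`, has zero last row, then the hyperplane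
`{y : (Q y)₄ = 0}` contains `X y` for every `y` — a common invariant hyperplane. [NOTE-iota4 §2c; spec S2] -/
theorem reducible_of_conj_row_zero (V : Submodule ℂ (Matrix (Fin 4) (Fin 4) ℂ))
    (Q P : Matrix (Fin 4) (Fin 4) ℂ) (hQP : Q * P = 1) (hPQ : P * Q = 1)
    (hrow : ∀ X ∈ V, ∀ j, (Q * X * P) 3 j = 0) :
    ∃ U : Submodule ℂ (Fin 4 → ℂ), U ≠ ⊥ ∧ U ≠ ⊤ ∧ ∀ A ∈ V, ∀ u ∈ U, A *ᵥ u ∈ U := by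
  let φ : (Fin 4 → ℂ) →ₗ[ℂ] ℂ := (LinearMap.proj 3).comp (Matrix.mulVecLin Q)
  have hφ : ∀ y, φ y = (Q *ᵥ y) 3 := fun y => rfl
  have hinv : ∀ A ∈ V, ∀ y, φ (A *ᵥ y) = 0 := by
    intro A hA y
    rw [hφ, Matrix.mulVec_mulVec]
    have h2 : Q * A = (Q * A * P) * Q := by
      simp only [Matrix.mul_assoc]; rw [hPQ, Matrix.mul_one]
    rw [h2, ← Matrix.mulVec_mulVec, Matrix.mulVec, dotProduct]
    exact Finset.sum_eq_zero fun j _ => by rw [hrow A hA j, zero_mul]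
  refine ⟨LinearMap.ker φ, ?_, ?_, ?_⟩
  · -- `P e₁ ∈ ker φ` and `P e₁ ≠ 0`
    intro hbot
    have hmem : P *ᵥ (Pi.single 0 1 : Fin 4 → ℂ) ∈ LinearMap.ker φ := by
      rw [LinearMap.mem_ker, hφ, Matrix.mulVec_mulVec, hQP, Matrix.one_mulVec]; simp
    rw [hbot, Submodule.mem_bot] at hmem
    have : (Q * P) *ᵥ (Pi.single 0 1 : Fin 4 → ℂ) = 0 := by
      rw [← Matrix.mulVec_mulVec, hmem, Matrix.mulVec_zero]
    rw [hQP, Matrix.one_mulVec] at this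
    exact one_ne_zero ((congrFun this 0).symm.trans (by simp) |>.symm : (1 : ℂ) = 0)
  · -- `P e₄ ∉ ker φ`
    intro htop
    have hmem : P *ᵥ (Pi.single 3 1 : Fin 4 → ℂ) ∈ LinearMap.ker φ := by rw [htop]; exact Submodule.mem_top
    rw [LinearMap.mem_ker, hφ, Matrix.mulVec_mulVec, hQP, Matrix.one_mulVec] at hmem
    simp at hmem
  · intro A hA u _
    rw [LinearMap.mem_ker]
    exact hinv A hA u

/-! ## §4 Case (a): square-zero spaces -/

/-- **Case (a).**  A linear space of SQUARE-ZERO `4 × 4` matrices with a non-zero member `A₀` is reducible: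
`ker A₀` is a proper non-zero common invariant subspace (✓ `reducible_of_sq_zero`). [NOTE-iota4 §1; spec S2(a)] -/
theorem reducible_of_forall_sq_zero (V : Submodule ℂ (Matrix (Fin 4) (Fin 4) ℂ)) (hsq : ∀ A ∈ V, A * A = 0)
    {A₀ : Matrix (Fin 4) (Fin 4) ℂ} (hA₀ : A₀ ∈ V) (hne : A₀ ≠ 0) :
    ∃ U : Submodule ℂ (Fin 4 → ℂ), U ≠ ⊥ ∧ U ≠ ⊤ ∧ ∀ A ∈ V, ∀ u ∈ U, A *ᵥ u ∈ U := by
  -- a column `A₀ e_j ≠ 0`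
  obtain ⟨j, hj⟩ : ∃ j, A₀ *ᵥ (Pi.single j 1 : Fin 4 → ℂ) ≠ 0 := by
    by_contra h
    push Not at h
    exact hne (eq_zero_of_forall_mulVec_single A₀ h)
  refine ⟨LinearMap.ker (Matrix.mulVecLin A₀), ?_, ?_, ?_⟩
  · intro hbot
    have hmem : A₀ *ᵥ (Pi.single j 1 : Fin 4 → ℂ) ∈ LinearMap.ker (Matrix.mulVecLin A₀) := by
      rw [LinearMap.mem_ker, Matrix.mulVecLin_apply, Matrix.mulVec_mulVec, hsq A₀ hA₀, Matrix.zero_mulVec]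
    rw [hbot, Submodule.mem_bot] at hmem
    exact hj hmem
  · intro htop
    have hmem : (Pi.single j 1 : Fin 4 → ℂ) ∈ LinearMap.ker (Matrix.mulVecLin A₀) := by
      rw [htop]; exact Submodule.mem_top
    rw [LinearMap.mem_ker, Matrix.mulVecLin_apply] at hmem
    exact hj hmem
  · intro A hA u hu
    rw [LinearMap.mem_ker, Matrix.mulVecLin_apply] at hu ⊢
    exact reducible_of_sq_zero V hsq hA₀ hA u hu

end Summit.ValiantsHypothesis.ValiantsHypothesis.Theorems.GrenetZeon.HeavyTopIotaFour

end
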